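import Mathlib

/-!
# Route PlaneEnergyCeiling · crux `PlanarEnergyAPriori` — calculus of the flux-convergence budget

Helper file for the crux item stmt-NavierStokesRegularity-16855 (`PlanarEnergyAPriori`, route
`PlaneEnergyCeiling`), toward its single open piece, the parabolic flux-convergence budget
(`stub_fluxConvergenceBudget` of the line `Cruxes/PlanarEnergyAPriori/Lines/birth.lean`):
`∫₀ᵗ (πν(t−s))^{-1/2} · osc_c F(s;R,·) ds ≤ B` uniformly in `t < T`. This file is the elementary
calculus of that functional, for an ABSTRACT oscillation `O : ℝ → ℝ≥0∞`:

* `lintegral_Ioo_rpow_sub` — `∫₀ᵗ (t − s)^r ds = t^{r+1}/(r+1)` for `−1 < r` (as an `ℝ≥0∞` integral);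
* `fluxBudget_le_of_oscRate` — **a subcritical oscillation rate closes the budget**: if
  `O(s) ≤ A (T − s)^{−α}` on `(0,T)` with `0 ≤ α < 1/2`, then for every `t ∈ [0,T)`
  `∫₀ᵗ (√(πν(t−s)))⁻¹ O(s) ds ≤ (√(πν))⁻¹ A T^{1/2−α}/(1/2 − α)` — uniformly in `t`. The Type-I
  (self-similar) rate is the borderline `α = 1/2` (log-divergent budget), matching the planar
  log-divergence the crux excludes; any rate `α < 1/2` on the flux oscillation would settle the crux
  through the landed reduction `planarEnergyAPriori_of_fluxConvergenceBudget`.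
* `fluxBudget_le_of_bounded` — in particular a bounded oscillation (`α = 0`; e.g. on every compact
  `[0,t]` by the persisted decay) gives the budget `≤ 2 (√(πν))⁻¹ A √T`: the content of the stub is
  only the behaviour of `osc_c F(s)` as `s ↑ T`.

Folklore (Beta-integral bookkeeping).
-/

noncomputable section

-- single-conjunct summit: `Summit.<Summit>.<Problem>` repeats the name by the D-0017 layout
set_option linter.dupNamespace false

namespace Summit.NavierStokesRegularity.NavierStokesRegularity.Theorems.PlanarEnergyAPriori

open MeasureTheory Set Real
open scoped ENNReal

/-! ### The power integral -/

/-- `s ↦ (t − s)^r` is integrable on `(0,t)` for `−1 < r`. -/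
theorem integrableOn_rpow_sub {r : ℝ} (hr : -1 < r) (t : ℝ) :
    IntegrableOn (fun s : ℝ => (t - s) ^ r) (Ioo 0 t) := by
  have h := ((intervalIntegral.intervalIntegrable_rpow' hr (a := 0) (b := t)).comp_sub_left t).symm
  simp only [sub_zero, sub_self] at h
  exact h.1.mono_set Ioo_subset_Ioc_self

/-- `∫₀ᵗ (t − s)^r ds = t^{r+1}/(r+1)` for `−1 < r`, `0 ≤ t`. -/
theorem integral_Ioo_rpow_sub {r : ℝ} (hr : -1 < r) {t : ℝ} (ht : 0 ≤ t) :
    ∫ s in Ioo 0 t, (t - s) ^ r = t ^ (r + 1) / (r + 1) := by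
  rw [← integral_Ioc_eq_integral_Ioo, ← intervalIntegral.integral_of_le ht,
    intervalIntegral.integral_comp_sub_left (fun x : ℝ => x ^ r) t, sub_self, sub_zero, integral_rpow (Or.inl hr),
    Real.zero_rpow (by linarith), sub_zero]

/-! ### A subcritical oscillation rate closes the budget -/

/-- The kernel weight factorises: `(√(πν(t−s)))⁻¹ = (√(πν))⁻¹ (t − s)^{−1/2}` for `s < t`. -/
theorem inv_sqrt_mul_sub_eq {ν t s : ℝ} (hν : 0 ≤ ν) (hs : s < t) :
    (Real.sqrt (π * ν * (t - s)))⁻¹ = (Real.sqrt (π * ν))⁻¹ * (t - s) ^ (-(1 / 2 : ℝ)) := by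
  rw [Real.sqrt_mul (by positivity) (t - s), mul_inv, Real.sqrt_eq_rpow (t - s), Real.rpow_neg (by linarith)]

/-- **A subcritical oscillation rate closes the budget.** Let `ν > 0`, `T > 0`, `A ≥ 0`,
`0 ≤ α < 1/2`, and `O : ℝ → ℝ≥0∞` with `O(s) ≤ A(T − s)^{−α}` for `s ∈ (0,T)`. Then for every
`t ∈ [0,T)`: `∫_{(0,t)} (√(πν(t−s)))⁻¹ O(s) ds ≤ (√(πν))⁻¹ A T^{1/2−α}/(1/2 − α)`. [folklore] -/
theorem fluxBudget_le_of_oscRate {ν T A α : ℝ} (hν : 0 < ν) (hA : 0 ≤ A) (hα0 : 0 ≤ α) (hα : α < 1 / 2)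
    {O : ℝ → ℝ≥0∞} (hosc : ∀ s ∈ Ioo 0 T, O s ≤ ENNReal.ofReal (A * (T - s) ^ (-α)))
    {t : ℝ} (ht : t ∈ Ico 0 T) :
    ∫⁻ s in Ioo 0 t, ENNReal.ofReal ((Real.sqrt (π * ν * (t - s)))⁻¹) * O s ≤
      ENNReal.ofReal ((Real.sqrt (π * ν))⁻¹ * A * T ^ (1 / 2 - α) / (1 / 2 - α)) := by
  set K : ℝ := (Real.sqrt (π * ν))⁻¹ * A with hK
  have hK0 : 0 ≤ K := by positivity
  set r : ℝ := -(1 / 2 + α) with hr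
  have hr1 : -1 < r := by rw [hr]; linarith
  have hr' : r + 1 = 1 / 2 - α := by rw [hr]; ring
  -- pointwise bound of the integrand on `(0,t)`
  have hpt : ∀ s ∈ Ioo 0 t, ENNReal.ofReal ((Real.sqrt (π * ν * (t - s)))⁻¹) * O s ≤
      ENNReal.ofReal (K * (t - s) ^ r) := by
    intro s hs
    have hts : 0 < t - s := by linarith [hs.2]
    have hsT : s ∈ Ioo 0 T := ⟨hs.1, hs.2.trans ht.2⟩
    have hmono : (T - s) ^ (-α) ≤ (t - s) ^ (-α) :=
      Real.rpow_le_rpow_of_nonpos hts (by linarith [ht.2]) (by linarith)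
    calc ENNReal.ofReal ((Real.sqrt (π * ν * (t - s)))⁻¹) * O s
        ≤ ENNReal.ofReal ((Real.sqrt (π * ν * (t - s)))⁻¹) * ENNReal.ofReal (A * (t - s) ^ (-α)) := by
          gcongr
          exact (hosc s hsT).trans (ENNReal.ofReal_le_ofReal (mul_le_mul_of_nonneg_left hmono hA))
      _ = ENNReal.ofReal (K * (t - s) ^ r) := by
          rw [← ENNReal.ofReal_mul (by positivity), inv_sqrt_mul_sub_eq hν.le hs.2, hK, hr, neg_add,
            Real.rpow_add hts]
          ring_nf
  -- integrate
  have hint : IntegrableOn (fun s : ℝ => K * (t - s) ^ r) (Ioo 0 t) := (integrableOn_rpow_sub hr1 t).const_mul K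
  have hnn : ∀ s ∈ Ioo 0 t, 0 ≤ K * (t - s) ^ r := fun s hs =>
    mul_nonneg hK0 (Real.rpow_nonneg (by linarith [hs.2]) _)
  calc ∫⁻ s in Ioo 0 t, ENNReal.ofReal ((Real.sqrt (π * ν * (t - s)))⁻¹) * O s
      ≤ ∫⁻ s in Ioo 0 t, ENNReal.ofReal (K * (t - s) ^ r) := setLIntegral_mono' measurableSet_Ioo hpt
    _ = ENNReal.ofReal (∫ s in Ioo 0 t, K * (t - s) ^ r) :=
        (ofReal_integral_eq_lintegral_ofReal hint ((ae_restrict_iff' measurableSet_Ioo).2 (ae_of_all _ hnn))).symm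
    _ = ENNReal.ofReal (K * t ^ (1 / 2 - α) / (1 / 2 - α)) := by
        rw [integral_const_mul, integral_Ioo_rpow_sub hr1 ht.1, hr', mul_div_assoc]
    _ ≤ ENNReal.ofReal ((Real.sqrt (π * ν))⁻¹ * A * T ^ (1 / 2 - α) / (1 / 2 - α)) := by
        refine ENNReal.ofReal_le_ofReal ?_
        rw [hK]
        have h1 : t ^ (1 / 2 - α) ≤ T ^ (1 / 2 - α) := Real.rpow_le_rpow ht.1 ht.2.le (by linarith)
        have h2 : 0 < 1 / 2 - α := by linarith
        exact div_le_div_of_nonneg_right (mul_le_mul_of_nonneg_left h1 hK0) h2.le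

/-- **A bounded oscillation gives a budget of parabolic size**: if `O(s) ≤ A` on `(0,T)` then for
`t ∈ [0,T)`: `∫_{(0,t)} (√(πν(t−s)))⁻¹ O(s) ds ≤ 2 (√(πν))⁻¹ A √T`. (The case `α = 0`; along a
classical solution with persisted decay on `[0,t]` the flux oscillation IS bounded on `[0,t]`, so the
content of `stub_fluxConvergenceBudget` is only the behaviour of `osc_c F(s)` as `s ↑ T`.)
[folklore] -/
theorem fluxBudget_le_of_bounded {ν T A : ℝ} (hν : 0 < ν) (hA : 0 ≤ A)
    {O : ℝ → ℝ≥0∞} (hosc : ∀ s ∈ Ioo 0 T, O s ≤ ENNReal.ofReal A) {t : ℝ} (ht : t ∈ Ico 0 T) :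
    ∫⁻ s in Ioo 0 t, ENNReal.ofReal ((Real.sqrt (π * ν * (t - s)))⁻¹) * O s ≤
      ENNReal.ofReal (2 * (Real.sqrt (π * ν))⁻¹ * A * Real.sqrt T) := by
  have h := fluxBudget_le_of_oscRate (α := 0) hν hA le_rfl (by norm_num)
    (fun s hs => by simpa using hosc s hs) ht
  refine h.trans (le_of_eq ?_)
  congr 1
  rw [sub_zero, Real.sqrt_eq_rpow T]
  ring

/-- **A subcritical oscillation rate closes the budget, registered closed form** (sub-goal
`fluxBudget_le_of_oscRate_closedForm` of stmt-NavierStokesRegularity-16855, toward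
`stub_fluxConvergenceBudget`). [folklore] -/
theorem fluxBudget_le_of_oscRate_closedForm : ∀ (ν T A α : ℝ), 0 < ν → 0 ≤ A → 0 ≤ α → α < 1 / 2 → ∀ (O : ℝ → ENNReal), (∀ s ∈ Set.Ioo 0 T, O s ≤ ENNReal.ofReal (A * (T - s) ^ (-α))) → ∀ t ∈ Set.Ico 0 T, ∫⁻ s in Set.Ioo 0 t, ENNReal.ofReal ((Real.sqrt (Real.pi * ν * (t - s)))⁻¹) * O s ≤ ENNReal.ofReal ((Real.sqrt (Real.pi * ν))⁻¹ * A * T ^ (1 / 2 - α) / (1 / 2 - α)) :=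
  fun _ _ _ _ hν hA hα0 hα _ hosc _ ht => fluxBudget_le_of_oscRate hν hA hα0 hα hosc ht

end Summit.NavierStokesRegularity.NavierStokesRegularity.Theorems.PlanarEnergyAPriori

end
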